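/-
Literature file (hubbard-downfold front-end, the «molecular-unit / cluster-unit» boxes: organic ET dimers, Mo₆
Chevrel clusters, the Star-of-David cluster of CCDW 1T-TaS₂, C₆₀ molecules): the projection identity that
turns an ATOMIC on-site repulsion `U` into the effective repulsion `U_eff` of ONE cluster/molecular orbital,
`U_eff / U = Σ_{a, m} |⟨d_{am}|Ψ⟩|⁴` (Darancet–Millis–Marianetti 2014, eq. (1)), with its elementary bounds.
-/
import Mathlib
import HarnessLib

/-!
# Effective on-site repulsion of a cluster orbital: `U_eff = U · Σ |⟨φ_i|Ψ⟩|⁴`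

When a narrow band at the Fermi level is built from ONE orbital `Ψ` per cluster (dimer, Mo₆ octahedron,
13-site Star of David, …) and the bare repulsion acts on the ATOMIC orbitals `φ_i` with strength `U`
(density–density, no inter-site terms), the repulsion felt by two electrons in `Ψ` is
`U_eff = U Σ_i |⟨φ_i|Ψ⟩|⁴`: «The difference may be quantified by projecting the Wannier function `|Ψ⟩` of the
band in the gap onto the local d-orbitals `|d_{am}⟩` … `U_eff/U = Σ_{a∈★,m} |⟨d_{am}|Ψ⟩|⁴`»
[cite: DarancetMillisMarianetti2014, eq. (1)] — for CCDW 1T-TaS₂ this gives `U_eff ≈ 0.18 eV ≈ 8 %` of the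
atomic `U = 2.27 eV`, with `79 %` of the orbital on Ta, `20–25 %` on the central Ta and `4–6 %` on each of the
twelve outer Ta [cite: DarancetMillisMarianetti2014, p. 3 (text following eq. (1))].

Writing `w_i := |⟨φ_i|Ψ⟩|² ≥ 0` for the WEIGHTS of `Ψ` on the atomic orbitals (`Σ_i w_i ≤ 1`, `= 1` when the
`φ_i` exhaust `Ψ`), the ratio is the inverse participation sum `ipr w = Σ_i w_i²`.  Everything below is
elementary real analysis on such weight vectors (PROVED; no named facts):

* `ipr_le_sup_mul_sum` — `Σ w_i² ≤ M · Σ w_i` when `0 ≤ w_i ≤ M`; hence `ipr ≤ 1` for a normalised weight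
  (`ipr_le_one`) : `U_eff ≤ U` (`effU_le`).
* `sq_sum_le_card_mul_ipr` — Cauchy–Schwarz `(Σ w_i)² ≤ n · Σ w_i²`; hence `1/n ≤ ipr` for a normalised
  weight on `n` orbitals (`inv_card_le_ipr`) : `U/n ≤ U_eff` (`div_card_le_effU`), with equality for the
  UNIFORM cluster orbital `w_i = 1/n` (`ipr_uniform`, `effU_uniform`): dimer `U/2`, Mo₆ `U/6`, Star of David
  `U/13` (`effU_dimer`, `effU_hexamer`, `effU_star13`).
* Restriction to a sub-cluster `s` carrying weight `f = Σ_{i∈s} w_i`: `f²/|s| ≤ Σ_{i∈s} w_i²`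
  (`sq_sumOn_le_card_mul_iprOn`).
* Orbital resolution on one atom: if atom `a` carries `w_a = Σ_m v_{am}` with `v_{am} ≥ 0`, then
  `Σ_m v_{am}² ≤ w_a²` (`sum_sq_le_sq_sum_of_nonneg`) — the `m`-resolved fourth-power sum is bounded by the
  per-atom one.
* The printed 1T-TaS₂ weights as a BOX (`darancet_star_corners`): `w(Ta-I) ∈ [0.20, 0.25]`, twelve outer
  `w ∈ [0.04, 0.06]` ⇒ `Σ_Ta w² ∈ [0.0592, 0.1057]` ⇒ `U_eff ≤ 0.1057 · 2.27 < 0.24 eV`, and the printed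
  `8 %` of `2.27 eV` is `0.1816 eV` (`darancet_eight_percent`).

WHAT THIS IS NOT: a derivation of the density–density projection itself from a many-body Hamiltonian
(inter-site Coulomb terms `V_{ij}`, which ADD `Σ_{i≠j} V_{ij} w_i w_j` to `U_eff`, are outside this identity —
the organic-dimer literature's caveat), nor any statement about screening (`U` here is whatever atomic `U`
the source prints: cRPA, linear response, …), nor about bandwidths.
-/

noncomputable section

namespace Literature.MathematicalPhysics.QuantumManyBody

namespace ClusterOrbitalEffectiveU

open Finset

variable {ι : Type*} [Fintype ι]

/-! ## The inverse participation sum and `U_eff` -/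

/-- Inverse participation sum `Σ_i w_i²` of a weight vector `w_i = |⟨φ_i|Ψ⟩|²` (so `Σ_i w_i² = Σ_i |⟨φ_i|Ψ⟩|⁴`).
[cite: DarancetMillisMarianetti2014, eq. (1)] -/
def ipr (w : ι → ℝ) : ℝ := ∑ i, w i ^ 2

/-- The effective repulsion of the cluster orbital: `U_eff = U · Σ_i |⟨φ_i|Ψ⟩|⁴ = U · ipr w`.
[cite: DarancetMillisMarianetti2014, eq. (1)] -/
def effU (U : ℝ) (w : ι → ℝ) : ℝ := U * ipr w

/-- Restricted participation sum over a sub-cluster `s`. [cite: DarancetMillisMarianetti2014, eq. (1) (the sum over `a ∈ ★`)] -/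
def iprOn (s : Finset ι) (w : ι → ℝ) : ℝ := ∑ i ∈ s, w i ^ 2

/-- `ipr ≥ 0`. [cite: DarancetMillisMarianetti2014, eq. (1)] -/
theorem ipr_nonneg (w : ι → ℝ) : 0 ≤ ipr w :=
  Finset.sum_nonneg fun i _ => sq_nonneg (w i)

/-- `ipr w = iprOn univ w`. [cite: DarancetMillisMarianetti2014, eq. (1)] -/
theorem ipr_eq_iprOn_univ (w : ι → ℝ) : ipr w = iprOn univ w := rfl

/-! ## Upper bound: `U_eff ≤ U` -/

/-- If `0 ≤ w_i ≤ M` for all `i` then `Σ w_i² ≤ M · Σ w_i`. [cite: DarancetMillisMarianetti2014, eq. (1) (elementary consequence)] -/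
theorem ipr_le_sup_mul_sum {w : ι → ℝ} {M : ℝ} (h0 : ∀ i, 0 ≤ w i) (hM : ∀ i, w i ≤ M) :
    ipr w ≤ M * ∑ i, w i := by
  unfold ipr
  rw [Finset.mul_sum]
  refine Finset.sum_le_sum fun i _ => ?_
  rw [sq]
  exact mul_le_mul_of_nonneg_right (hM i) (h0 i)

/-- Each weight of a normalised non-negative vector is at most `1`. [cite: DarancetMillisMarianetti2014, eq. (1) (elementary consequence)] -/
theorem le_one_of_sum_eq_one {w : ι → ℝ} (h0 : ∀ i, 0 ≤ w i) (h1 : ∑ i, w i = 1) (i : ι) : w i ≤ 1 := by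
  rw [← h1]
  exact Finset.single_le_sum (fun j _ => h0 j) (Finset.mem_univ i)

/-- NORMALISED WEIGHTS: `Σ w_i = 1`, `w_i ≥ 0` ⇒ `ipr w ≤ 1`. [cite: DarancetMillisMarianetti2014, eq. (1) (elementary consequence)] -/
theorem ipr_le_one {w : ι → ℝ} (h0 : ∀ i, 0 ≤ w i) (h1 : ∑ i, w i = 1) : ipr w ≤ 1 := by
  have := ipr_le_sup_mul_sum h0 (le_one_of_sum_eq_one h0 h1)
  simpa [h1] using this

/-- SUB-NORMALISED WEIGHTS (only part of `Ψ` on the listed orbitals): `Σ w_i ≤ 1` ⇒ `ipr w ≤ Σ w_i ≤ 1`.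
[cite: DarancetMillisMarianetti2014, eq. (1) with p. 3 («79% of the lower-Hubbard band lies on the tantalum atoms»)] -/
theorem ipr_le_sum {w : ι → ℝ} (h0 : ∀ i, 0 ≤ w i) (h1 : ∑ i, w i ≤ 1) : ipr w ≤ ∑ i, w i := by
  have hle : ∀ i, w i ≤ 1 := fun i =>
    le_trans (Finset.single_le_sum (fun j _ => h0 j) (Finset.mem_univ i)) h1
  have := ipr_le_sup_mul_sum h0 hle
  simpa using this

/-- `U_eff ≤ U` for `U ≥ 0` and normalised weights. [cite: DarancetMillisMarianetti2014, eq. (1) («effective interaction much smaller (∼ 8%) than the on-site U»)] -/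
theorem effU_le {U : ℝ} (hU : 0 ≤ U) {w : ι → ℝ} (h0 : ∀ i, 0 ≤ w i) (h1 : ∑ i, w i = 1) :
    effU U w ≤ U := by
  have := mul_le_mul_of_nonneg_left (ipr_le_one h0 h1) hU
  simpa [effU] using this

/-! ## Lower bound: `U/n ≤ U_eff` (Cauchy–Schwarz), equality for the uniform cluster orbital -/

omit [Fintype ι] in
/-- Cauchy–Schwarz on a sub-cluster: `(Σ_{i∈s} w_i)² ≤ |s| · Σ_{i∈s} w_i²`. [cite: DarancetMillisMarianetti2014, eq. (1) (elementary consequence; Cauchy–Schwarz)] -/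
theorem sq_sumOn_le_card_mul_iprOn (s : Finset ι) (w : ι → ℝ) :
    (∑ i ∈ s, w i) ^ 2 ≤ (s.card : ℝ) * iprOn s w := by
  unfold iprOn
  exact sq_sum_le_card_mul_sum_sq

/-- Cauchy–Schwarz on the whole cluster: `(Σ w_i)² ≤ n · ipr w`, `n = |ι|`. [cite: DarancetMillisMarianetti2014, eq. (1) (elementary consequence)] -/
theorem sq_sum_le_card_mul_ipr (w : ι → ℝ) :
    (∑ i, w i) ^ 2 ≤ (Fintype.card ι : ℝ) * ipr w := by
  simpa [ipr, iprOn, Finset.card_univ] using sq_sumOn_le_card_mul_iprOn (univ : Finset ι) w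

/-- NORMALISED WEIGHTS on `n ≥ 1` orbitals: `1/n ≤ ipr w`. [cite: DarancetMillisMarianetti2014, eq. (1) (elementary consequence)] -/
theorem inv_card_le_ipr [Nonempty ι] {w : ι → ℝ} (h1 : ∑ i, w i = 1) :
    1 / (Fintype.card ι : ℝ) ≤ ipr w := by
  have hn : (0 : ℝ) < Fintype.card ι := by exact_mod_cast Fintype.card_pos
  have h := sq_sum_le_card_mul_ipr w
  rw [h1, one_pow] at h
  rw [div_le_iff₀ hn]
  linarith [mul_comm (Fintype.card ι : ℝ) (ipr w)]

omit [Fintype ι] in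
/-- WEIGHT `f` SPREAD OVER A SUB-CLUSTER `s` (`|s| ≥ 1`): `f²/|s| ≤ Σ_{i∈s} w_i²`.
[cite: DarancetMillisMarianetti2014, eq. (1) with p. 3 (79 % on the 13 Ta)] -/
theorem sq_div_card_le_iprOn {s : Finset ι} (hs : s.Nonempty) (w : ι → ℝ) :
    (∑ i ∈ s, w i) ^ 2 / (s.card : ℝ) ≤ iprOn s w := by
  have hn : (0 : ℝ) < s.card := by exact_mod_cast hs.card_pos
  rw [div_le_iff₀ hn]
  have := sq_sumOn_le_card_mul_iprOn s w
  linarith [mul_comm (s.card : ℝ) (iprOn s w)]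

/-- `U/n ≤ U_eff` for `U ≥ 0` and normalised weights on `n ≥ 1` orbitals. [cite: DarancetMillisMarianetti2014, eq. (1) (elementary consequence)] -/
theorem div_card_le_effU [Nonempty ι] {U : ℝ} (hU : 0 ≤ U) {w : ι → ℝ} (h1 : ∑ i, w i = 1) :
    U / (Fintype.card ι : ℝ) ≤ effU U w := by
  have h := mul_le_mul_of_nonneg_left (inv_card_le_ipr h1) hU
  unfold effU
  calc U / (Fintype.card ι : ℝ) = U * (1 / (Fintype.card ι : ℝ)) := by ring
    _ ≤ U * ipr w := h

/-- THE UNIFORM CLUSTER ORBITAL `w_i = 1/n`: `ipr = 1/n`. [cite: DarancetMillisMarianetti2014, eq. (1) (elementary consequence)] -/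
theorem ipr_uniform [Nonempty ι] :
    ipr (fun _ : ι => 1 / (Fintype.card ι : ℝ)) = 1 / (Fintype.card ι : ℝ) := by
  have hn : (Fintype.card ι : ℝ) ≠ 0 := by exact_mod_cast Fintype.card_ne_zero
  simp only [ipr, Finset.sum_const, Finset.card_univ, nsmul_eq_mul]
  field_simp

/-- The uniform cluster orbital is normalised: `Σ_i 1/n = 1`. [cite: DarancetMillisMarianetti2014, eq. (1) (elementary consequence)] -/
theorem sum_uniform [Nonempty ι] : ∑ _i : ι, 1 / (Fintype.card ι : ℝ) = 1 := by
  have hn : (Fintype.card ι : ℝ) ≠ 0 := by exact_mod_cast Fintype.card_ne_zero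
  simp only [Finset.sum_const, Finset.card_univ, nsmul_eq_mul]
  field_simp

/-- `U_eff = U/n` for the uniform cluster orbital on `n` sites. [cite: DarancetMillisMarianetti2014, eq. (1) (elementary consequence)] -/
theorem effU_uniform [Nonempty ι] (U : ℝ) :
    effU U (fun _ : ι => 1 / (Fintype.card ι : ℝ)) = U / (Fintype.card ι : ℝ) := by
  rw [effU, ipr_uniform]
  ring

/-- A fully LOCALISED orbital (all weight on one atomic orbital `i₀`): `ipr = 1`, `U_eff = U`.
[cite: DarancetMillisMarianetti2014, eq. (1) (elementary consequence)] -/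
theorem ipr_single [DecidableEq ι] (i₀ : ι) : ipr (fun i : ι => if i = i₀ then (1 : ℝ) else 0) = 1 := by
  simp [ipr, Finset.sum_ite_eq', apply_ite (· ^ 2)]

/-! ## Orbital resolution on one atom -/

/-- For non-negative `v_m` with `Σ_m v_m = w`: `Σ_m v_m² ≤ w²` — resolving one atom's weight into its `m`
orbitals can only LOWER the fourth-power sum. [cite: DarancetMillisMarianetti2014, eq. (1) (the inner sum over `m`)] -/
theorem sum_sq_le_sq_sum_of_nonneg {κ : Type*} (s : Finset κ) {v : κ → ℝ} (h0 : ∀ m ∈ s, 0 ≤ v m) :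
    ∑ m ∈ s, v m ^ 2 ≤ (∑ m ∈ s, v m) ^ 2 := by
  rw [sq, Finset.sum_mul_sum]
  refine Finset.sum_le_sum fun m hm => ?_
  rw [sq]
  calc v m * v m = ∑ m' ∈ {m}, v m * v m' := by simp
    _ ≤ ∑ m' ∈ s, v m * v m' :=
        Finset.sum_le_sum_of_subset_of_nonneg (Finset.singleton_subset_iff.mpr hm)
          (fun m' hm' _ => mul_nonneg (h0 m hm) (h0 m' hm'))

/-! ## Instances: dimer, Mo₆ octahedron, Star of David -/

/-- DIMER (two equivalent molecules, bonding or antibonding orbital, `w = (½, ½)`): `U_eff = U/2`.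
[cite: DarancetMillisMarianetti2014, eq. (1) (n = 2 instance)] -/
theorem effU_dimer (U : ℝ) : effU U (fun _ : Fin 2 => (1 / 2 : ℝ)) = U / 2 := by
  simp [effU, ipr]; ring

/-- HEXAMER (e.g. an Mo₆-cluster orbital spread evenly over six metal atoms): `U_eff = U/6`.
[cite: DarancetMillisMarianetti2014, eq. (1) (n = 6 instance)] -/
theorem effU_hexamer (U : ℝ) : effU U (fun _ : Fin 6 => (1 / 6 : ℝ)) = U / 6 := by
  simp [effU, ipr]; ring

/-- STAR OF DAVID spread evenly over its 13 Ta atoms: `U_eff = U/13` (the uniform idealisation; the printed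
orbital is NOT uniform — see `darancet_star_corners`). [cite: DarancetMillisMarianetti2014, eq. (1) (n = 13 instance)] -/
theorem effU_star13 (U : ℝ) : effU U (fun _ : Fin 13 => (1 / 13 : ℝ)) = U / 13 := by
  simp [effU, ipr]; ring

/-! ## The printed 1T-TaS₂ weights as a box -/

/-- THE PRINTED STAR-OF-DAVID WEIGHTS AS A BOX: central Ta `w₀ ∈ [0.20, 0.25]`, each of the twelve outer Ta
`w_i ∈ [0.04, 0.06]` ⇒ the per-atom participation sum `Σ_{a∈★} w_a² ∈ [0.0592, 0.1057]` (corners; the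
`m`-resolved sum of eq. (1) is at most this by `sum_sq_le_sq_sum_of_nonneg`).
[cite: DarancetMillisMarianetti2014, p. 3 («only 20 to 25% is localized at the center … other twelve tantalum atoms each have … around 4-6%»)] -/
theorem darancet_star_corners (w : Fin 13 → ℝ) (hc0 : 0.20 ≤ w 0) (hc1 : w 0 ≤ 0.25)
    (ho0 : ∀ i, i ≠ 0 → 0.04 ≤ w i) (ho1 : ∀ i, i ≠ 0 → w i ≤ 0.06) :
    0.0592 ≤ ipr w ∧ ipr w ≤ 0.1057 := by
  have hsplit : ipr w = w 0 ^ 2 + ∑ i ∈ (univ : Finset (Fin 13)).erase 0, w i ^ 2 := by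
    rw [ipr, ← Finset.add_sum_erase _ _ (Finset.mem_univ (0 : Fin 13))]
  have hcard : ((univ : Finset (Fin 13)).erase 0).card = 12 := by simp
  have hlo : ∑ i ∈ (univ : Finset (Fin 13)).erase 0, w i ^ 2 ≥ 12 * 0.04 ^ 2 := by
    have : ∑ i ∈ (univ : Finset (Fin 13)).erase 0, (0.04 : ℝ) ^ 2 ≤
        ∑ i ∈ (univ : Finset (Fin 13)).erase 0, w i ^ 2 :=
      Finset.sum_le_sum fun i hi => by
        have hi0 : i ≠ 0 := Finset.ne_of_mem_erase hi
        exact pow_le_pow_left₀ (by norm_num) (ho0 i hi0) 2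
    simpa [hcard] using this
  have hhi : ∑ i ∈ (univ : Finset (Fin 13)).erase 0, w i ^ 2 ≤ 12 * 0.06 ^ 2 := by
    have : ∑ i ∈ (univ : Finset (Fin 13)).erase 0, w i ^ 2 ≤
        ∑ i ∈ (univ : Finset (Fin 13)).erase 0, (0.06 : ℝ) ^ 2 :=
      Finset.sum_le_sum fun i hi => by
        have hi0 : i ≠ 0 := Finset.ne_of_mem_erase hi
        exact pow_le_pow_left₀ (le_trans (by norm_num) (ho0 i hi0)) (ho1 i hi0) 2
    simpa [hcard] using this
  have hc2lo : 0.20 ^ 2 ≤ w 0 ^ 2 := pow_le_pow_left₀ (by norm_num) hc0 2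
  have hc2hi : w 0 ^ 2 ≤ 0.25 ^ 2 := pow_le_pow_left₀ (le_trans (by norm_num) hc0) hc1 2
  rw [hsplit]
  constructor <;> nlinarith

/-- Consequence for `U_eff` at the printed atomic `U = 2.27 eV`: `U_eff ≤ 0.1057 × 2.27 < 0.24 eV` on the
box (the printed value is `0.18 eV`). [cite: DarancetMillisMarianetti2014, p. 3 («U ≈ 2.27eV … U_eff = 0.18eV»)] -/
theorem darancet_effU_le (w : Fin 13 → ℝ) (hc0 : 0.20 ≤ w 0) (hc1 : w 0 ≤ 0.25)
    (ho0 : ∀ i, i ≠ 0 → 0.04 ≤ w i) (ho1 : ∀ i, i ≠ 0 → w i ≤ 0.06) :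
    effU 2.27 w < 0.24 := by
  have h := (darancet_star_corners w hc0 hc1 ho0 ho1).2
  unfold effU
  nlinarith

/-- The printed ratio: `8 %` of `2.27 eV` is `0.1816 eV` (printed `U_eff = 0.18 eV`), and it lies inside the
corner interval `[0.0592, 0.1057] × 2.27 = [0.134, 0.240]`. [cite: DarancetMillisMarianetti2014, p. 3 («∼ 8% … U_eff = 0.18eV»)] -/
theorem darancet_eight_percent :
    (0.08 : ℝ) * 2.27 = 0.1816 ∧ 0.0592 * 2.27 ≤ (0.18 : ℝ) ∧ (0.18 : ℝ) ≤ 0.1057 * 2.27 := by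
  refine ⟨by norm_num, by norm_num, by norm_num⟩

/-- The located ratios for CCDW 1T-TaS₂ (arithmetic on the printed numbers): `U_eff/W_∥ = 0.18/0.07 > 2`
(monolayer: Mott side) while `U_eff/W_c = 0.18/0.45 = 0.4 < 1` (bulk, vertical stacking: metallic side), and
the ATOMIC `U/W_∥ = 2.27/0.07 > 30`. [cite: DarancetMillisMarianetti2014, p. 3 («larger than the in-plane bandwidth (70meV) … much weaker than the out-of-plane bandwidth of the bulk (0.45eV)»)] -/
theorem darancet_ratios :
    (2 : ℝ) < 0.18 / 0.07 ∧ (0.18 : ℝ) / 0.45 = 0.4 ∧ (30 : ℝ) < 2.27 / 0.07 := by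
  refine ⟨by norm_num, by norm_num, by norm_num⟩

end ClusterOrbitalEffectiveU

end Literature.MathematicalPhysics.QuantumManyBody

end
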